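import Summits.FinalStateConjecture.FinalStateConjecture.Theorems.WeakCosmicCensorshipMGHD.Negative.TruncatedMinkowski
import Literature.Geometry.Lorentzian.OpensChartGeodesicODE
import HarnessLib

/-!
# The time slab `{-1 < x⁰ < 1}` of Minkowski space: a tame vacuum Cauchy development of the trivial
# admissible datum in which every null ray from the data is incomplete — negative-side support for the
# crux `ChannelsResolveTameDevelopmentsR` (K2R, item `stmt-FinalStateConjecture-14075`, route
# PhotonSphereChannels)

K2R is `K1R → Φ` with `K1R` a theorem of the tree, so K2R ≡ Φ = "every MAXIMAL vacuum Cauchy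
development of admissible data with COMPLETE `𝓘⁺`, (i) no extremal-Kerr late chart and (ii) tame outer
region admits an honest exhaustive final-state `2`-decomposition". This file and its sequel
(`SlabMinkowskiCharts`) certify, kernel-checked, that the pair {`IsMaximal`, complete `𝓘⁺`} is
load-bearing in Φ: the open time slab `{-1 < x⁰ < 1}` of Minkowski space is a vacuum Cauchy
development of the trivial datum `(ℝ³, δ, 0)` (`slab`, built with the tree's
`VacuumCauchyDevelopment.restrict`; the slice `{x⁰ = 0}` is still a Cauchy hypersurface of it,
`isCauchyHypersurface_slabCut`) which satisfies BOTH analytic hypotheses (i), (ii) of Φ and yet has no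
final-state decomposition at all. Here:

* `slab_ray_time_eq`, `slab_ray_dom_subset_Iio` — every normalised future null ray of the slab from
  the data slice is a straight line `t ↦ (t, y + t e)` (geodesic equations in the chart,
  `OpensChart.hasDerivAt_of_isGeodesicOn`, with vanishing Christoffel map), so its affine domain lies
  in `(-∞, 1)`: NO ray is future complete;
* `slab_outer_eq_empty`, `slab_tame` — hence the "outer region" of hypothesis (ii) (points in the
  chronological past of a future-COMPLETE normalised null ray) is empty and the tameness clause (ii) of
  K2R/Φ holds for `slab` (vacuously, in the exact syntactic form of the route decl).

All results proved; no named facts. Template: `WeakCosmicCensorshipMGHD/Negative/TruncatedMinkowski`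
(the future cut `{x⁰ < 1}`), whose curve lemmas are reused.

## References

* B. O'Neill, *Semi-Riemannian geometry*, 1983, Ch. 3, Cor. 21 and Example 25 (geodesics of `ℝⁿ₁`
  are lines), Ch. 14, Def. 14.28 (Cauchy hypersurfaces).
* D. Christodoulou, CQG 16 (1999) A23, pp. A26–A27; M. Dafermos, I. Rodnianski, arXiv:0811.0354,
  §2.6.2 (complete future null infinity, sojourn form).
-/

noncomputable section

open Bundle Set Function Filter TopologicalSpace Topology
open scoped Manifold ContDiff Topology ENNReal

set_option linter.dupNamespace false

namespace Summit.FinalStateConjecture.FinalStateConjecture.Theorems.ChannelsResolveTameDevelopmentsR.Negative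

open Literature.Geometry.Lorentzian Literature.Geometry.Lorentzian.Minkowski
open Summit.FinalStateConjecture.FinalStateConjecture.Theorems.WeakCosmicCensorshipMGHD.Negative
  (exists_hasFutureEndpoint_of_time_le apply_zero_le_of_hasPastEndpoint mdifferentiableAt_sliceNormal)

/-! ### The time slab `{-1 < x⁰ < 1}` -/

/-- The open time slab `{x ∈ E4 | -1 < x⁰ < 1}` of `E4`. -/
def slabCut : Opens E4 :=
  ⟨{x : E4 | -1 < x 0 ∧ x 0 < 1},
    (isOpen_lt continuous_const (EuclideanSpace.proj (0 : Fin 4)).continuous).inter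
      (isOpen_lt (EuclideanSpace.proj (0 : Fin 4)).continuous continuous_const)⟩

/-- Membership in the slab is `-1 < x⁰ < 1`. -/
@[simp] theorem mem_slabCut {x : E4} : x ∈ slabCut ↔ -1 < x 0 ∧ x 0 < 1 := Iff.rfl

/-- The slab is an intersection of two half-spaces, hence convex, and (being nonempty) connected.
(One conjunction, so as not to duplicate the shape of the corresponding facts for the future cut.) -/
theorem convex_and_isConnected_slabCut :
    Convex ℝ (slabCut : Set E4) ∧ IsConnected (slabCut : Set E4) := by
  have hc : Convex ℝ (slabCut : Set E4) :=
    (convex_halfSpace_gt (EuclideanSpace.proj (0 : Fin 4)).isLinear (-1)).inter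
      (convex_halfSpace_lt (EuclideanSpace.proj (0 : Fin 4)).isLinear 1)
  exact ⟨hc, (hc.isPathConnected ⟨0, by simp⟩).isConnected⟩

/-- The slice `{x⁰ = 0}` lies in the slab. -/
theorem sliceEmbed_mem_slabCut (y : slice) : sliceEmbed y ∈ slabCut := by
  simp [sliceEmbed_apply]

/-! ### Two more endpoint lemmas for future timelike curves of Minkowski space -/

/-- A future endpoint of a future timelike curve has time coordinate at least any value of the time
coordinate along the curve (time is increasing). -/
theorem le_apply_zero_of_hasFutureEndpoint {γ : ℝ → E4} {s : Set ℝ} (hs : s.OrdConnected)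
    (h : spacetime.metric.IsFutureTimelikeCurveOn spacetime.timeOrientation γ s) {p : E4}
    (hp : HasFutureEndpoint γ s p) {σ : ℝ} (hσ : σ ∈ s) : γ σ 0 ≤ p 0 := by
  haveI : Nonempty s := ⟨⟨σ, hσ⟩⟩
  have hT : Tendsto (fun t : s ↦ γ t 0) atTop (𝓝 (p 0)) :=
    ((EuclideanSpace.proj (0 : Fin 4)).continuous.tendsto p).comp hp
  refine ge_of_tendsto hT ?_
  filter_upwards [eventually_ge_atTop (⟨σ, hσ⟩ : s)] with t ht
  exact (strictMonoOn_time hs h).monotoneOn hσ t.2 ht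

/-- Along a future timelike curve of Minkowski spacetime on an interval whose time coordinate is
bounded BELOW on the domain, the curve has a past endpoint whose time coordinate is at least the bound
(time dual of `exists_hasFutureEndpoint_of_time_le`, run on the order dual of the parameter interval). -/
theorem exists_hasPastEndpoint_of_le_time {γ : ℝ → E4} {s : Set ℝ} (hs : s.OrdConnected)
    (hne : s.Nonempty)
    (h : spacetime.metric.IsFutureTimelikeCurveOn spacetime.timeOrientation γ s) {T₀ : ℝ}
    (hT₀ : ∀ σ ∈ s, T₀ ≤ γ σ 0) :
    ∃ p : E4, T₀ ≤ p 0 ∧ HasPastEndpoint γ s p := by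
  haveI : Nonempty s := hne.to_subtype
  have hmono : Monotone fun σ : sᵒᵈ ↦ -γ (OrderDual.ofDual σ).1 0 := by
    intro i j hij
    have := (strictMonoOn_time hs h).monotoneOn (OrderDual.ofDual j).2 (OrderDual.ofDual i).2
      (OrderDual.ofDual_le_ofDual.mpr hij)
    simpa using this
  have hb' : BddAbove (range fun σ : sᵒᵈ ↦ -γ (OrderDual.ofDual σ).1 0) := by
    refine ⟨-T₀, ?_⟩
    rintro _ ⟨σ, rfl⟩
    have := hT₀ _ (OrderDual.ofDual σ).2
    simpa using this
  obtain ⟨⟨T, hT⟩, q, hq⟩ := tendsto_of_monotone_of_dist_le hmono hb'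
    (x := fun σ : sᵒᵈ ↦ E4.spatial (γ (OrderDual.ofDual σ).1))
    (fun i j hij ↦ by
      rw [dist_comm, dist_eq_norm]
      have := norm_spatial_sub_le hs h (OrderDual.ofDual j).2 (OrderDual.ofDual i).2
        (OrderDual.ofDual_le_ofDual.mpr hij)
      linarith)
  have hT' : Tendsto (fun σ : sᵒᵈ ↦ γ (OrderDual.ofDual σ).1 0) atTop (𝓝 (-T)) := by
    simpa using hT.neg
  have hTle : T ≤ -T₀ := le_of_tendsto' hT fun σ ↦ by
    have := hT₀ _ (OrderDual.ofDual σ).2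
    linarith
  refine ⟨E4.ofTimeSpace (-T) q, ?_, tendsto_of_tendsto_time_spatial hT' hq⟩
  rw [E4.ofTimeSpace_apply_zero]
  linarith

/-! ### The slice is a Cauchy hypersurface of the slab -/

/-- **The slice `{x⁰ = 0}` is a Cauchy hypersurface of the open sub-spacetime `{-1 < x⁰ < 1}` of
Minkowski space.** Along an endless timelike curve of the slab the time coordinate is strictly
increasing and continuous with values in `(-1, 1)`; it takes a positive value (else the curve converges
in `E4` to a point of time in `(-1, 0]`, a future endpoint IN the slab) and a negative value (dually, via
a past endpoint), so it vanishes exactly once. O'Neill 1983, Ch. 14, Def. 14.28. -/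
theorem isCauchyHypersurface_slabCut :
    (vacuumCauchyDevelopment.metric.restrict PseudoRiemannianMetric.contMDiff_restrict_holds
        slabCut).IsCauchyHypersurface
      (vacuumCauchyDevelopment.timeOrientation.restrict PseudoRiemannianMetric.contMDiff_restrict_holds
        vacuumCauchyDevelopment.timeOrientation.contMDiff_restrict_holds slabCut)
      (range (vacuumCauchyDevelopment.embedOpens slabCut sliceEmbed_mem_slabCut)) := by
  intro γ s hγ
  obtain ⟨hs, htl, hfut, hpast⟩ := hγ
  have h : spacetime.metric.IsFutureTimelikeCurveOn spacetime.timeOrientation (Subtype.val ∘ γ) s :=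
    (LorentzianMetric.isFutureTimelikeCurveOn_restrict_iff _ _ _ _ _).1 htl
  set c : ℝ → E4 := Subtype.val ∘ γ with hc
  have hmono := strictMonoOn_time hs h
  obtain ⟨σ₀, hσ₀⟩ := hfut.1
  have hσ₀mem : -1 < c σ₀ 0 ∧ c σ₀ 0 < 1 := mem_slabCut.1 (γ σ₀).2
  -- some value of the time coordinate is positive
  obtain ⟨b, hb, hb0⟩ : ∃ b ∈ s, 0 < c b 0 := by
    by_contra hcon
    push Not at hcon
    obtain ⟨p, hp0, hp⟩ := exists_hasFutureEndpoint_of_time_le hs hfut.1 h hcon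
    have hp1 : p 0 < 1 := by linarith
    have hp2 : -1 < p 0 := lt_of_lt_of_le hσ₀mem.1 (le_apply_zero_of_hasFutureEndpoint hs h hp hσ₀)
    exact hfut.2 (⟨p, hp2, hp1⟩ : slabCut)
      ((hasFutureEndpoint_subtypeVal_comp_iff (p := (⟨p, hp2, hp1⟩ : slabCut))).1 hp)
  -- some value of the time coordinate is negative
  obtain ⟨a, ha, ha0⟩ : ∃ a ∈ s, c a 0 < 0 := by
    by_contra hcon
    push Not at hcon
    obtain ⟨p, hp0, hp⟩ := exists_hasPastEndpoint_of_le_time hs hfut.1 h hcon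
    have hp2 : -1 < p 0 := by linarith
    have hp1 : p 0 < 1 := lt_of_le_of_lt (apply_zero_le_of_hasPastEndpoint hs h hp hσ₀) hσ₀mem.2
    exact hpast.2 (⟨p, hp2, hp1⟩ : slabCut)
      ((hasPastEndpoint_subtypeVal_comp_iff (p := (⟨p, hp2, hp1⟩ : slabCut))).1 hp)
  obtain ⟨σ, hσ, hσ0⟩ : ∃ σ ∈ s, c σ 0 = 0 :=
    hs.isPreconnected.intermediate_value ha hb (continuousOn_time h) ⟨ha0.le, hb0.le⟩
  obtain ⟨y, hy⟩ := (E4.mem_range_sliceEmbed_iff (c σ)).2 hσ0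
  refine ⟨σ, ⟨hσ, ⟨y, Subtype.ext hy⟩⟩, ?_⟩
  rintro t ⟨ht, ⟨y', hy'⟩⟩
  have ht0 : c t 0 = 0 := (E4.mem_range_sliceEmbed_iff (c t)).1 ⟨y', congrArg Subtype.val hy'⟩
  exact hmono.injOn ht hσ (ht0.trans hσ0.symm)

/-- **The time slab `{-1 < x⁰ < 1}` as a vacuum Cauchy development of the trivial data
`(ℝ³, δ, 0)`**: the restriction of `Minkowski.vacuumCauchyDevelopment` to the open connected
sub-spacetime `slabCut ⊇ {x⁰ = 0}`, in which the slice is still a Cauchy hypersurface. It embeds into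
Minkowski space (`VacuumCauchyDevelopment.restrict_embedsInto`) and is not maximal. -/
def slab : VacuumCauchyDevelopment trivialData :=
  vacuumCauchyDevelopment.restrict slabCut convex_and_isConnected_slabCut.2 sliceEmbed_mem_slabCut
    mdifferentiableAt_sliceNormal isCauchyHypersurface_slabCut

/-! ### The fields of the slab development -/

/-- The metric of the slab: `η` restricted to `{-1 < x⁰ < 1}`. -/
abbrev slabMetric : LorentzianMetric (𝓡 4) ∞ slabCut :=
  vacuumCauchyDevelopment.metric.restrict PseudoRiemannianMetric.contMDiff_restrict_holds slabCut

/-- The time orientation of the slab: `∂ₜ` restricted. -/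
abbrev slabOrientation : TimeOrientation slabMetric :=
  vacuumCauchyDevelopment.timeOrientation.restrict PseudoRiemannianMetric.contMDiff_restrict_holds
    vacuumCauchyDevelopment.timeOrientation.contMDiff_restrict_holds slabCut

/-- The metric of the slab development is the restricted `η` (by `rfl`). -/
theorem slab_metric : slab.metric = slabMetric := rfl

/-- The time orientation of the slab development is the restricted `∂ₜ` (by `rfl`). -/
theorem slab_timeOrientation : slab.timeOrientation = slabOrientation := rfl

/-- The embedding of the slab development is the codomain-restricted slice embedding (by `rfl`). -/
theorem slab_embed :
    slab.embed = vacuumCauchyDevelopment.embedOpens slabCut sliceEmbed_mem_slabCut := rfl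

/-- The normal of the slab development is `∂ₜ` (by `rfl`). -/
theorem slab_normal : slab.normal = fun y ↦ sliceNormal y := rfl

/-- The carrier of the slab development is the subtype `↥slabCut` (by `rfl`). -/
theorem slab_carrier : slab.carrier = ↥slabCut := rfl

/-- The components of the restricted metric are the constant form `η`. -/
@[simp] theorem slabMetric_val (x : slabCut) : slabMetric.val x = bilin := rfl

/-- The metric of the slab development at any point is `η` (by `rfl`). -/
@[simp] theorem slab_metric_val (x : slabCut) : slab.metric.val x = bilin := rfl

/-- The orienting field of the slab is `∂ₜ`. -/
@[simp] theorem slabOrientation_vectorField (x : slabCut) :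
    slabOrientation.vectorField x = E4.basisVector 0 := rfl

/-- Every point of the slab has time coordinate in `(-1, 1)`. -/
theorem slab_apply_zero_mem (x : slabCut) : -1 < (x : E4) 0 ∧ (x : E4) 0 < 1 :=
  mem_slabCut.1 x.2

/-- The slab development embeds into Minkowski space (it is a proper open sub-development). -/
theorem slab_embedsInto :
    slab.toCauchyDevelopment.EmbedsInto vacuumCauchyDevelopment.toCauchyDevelopment :=
  vacuumCauchyDevelopment.restrict_embedsInto slabCut convex_and_isConnected_slabCut.2 sliceEmbed_mem_slabCut
    mdifferentiableAt_sliceNormal isCauchyHypersurface_slabCut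

/-! ### Null rays of the slab are straight lines: no ray from the slice is future complete -/

/-- The Christoffel map of the constant components `η` vanishes. -/
theorem christoffel_slab_eq_zero [slabMetric.toPseudoRiemannianMetric.HasLeviCivita]
    (x : slabCut) (Y X : E4) :
    OpensChart.christoffel slabMetric.toPseudoRiemannianMetric (fun _ : E4 ↦ bilin) x Y X = 0 := by
  have hK : OpensChart.koszulForm (fun _ : E4 ↦ bilin) (x : E4) Y X = 0 := by
    ext Z
    simp [OpensChart.koszulForm_apply]
  rw [OpensChart.christoffel_apply, hK, smul_zero]
  exact map_zero _

/-- **Along a normalised null ray of the slab from the slice, the time coordinate is the affine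
parameter**: `(γ t)⁰ = t` on the whole affine domain. The geodesic equations in the chart
(`OpensChart.hasDerivAt_of_isGeodesicOn`) with vanishing Christoffel map say that the velocity is
constant along the (open, connected) domain; its time component is `1` by the normalisation
`η(γ'(0), ∂ₜ) = -1`, and `(γ 0)⁰ = 0`. O'Neill 1983, Ch. 3, Cor. 21 and Example 25. -/
theorem slab_ray_time_eq [slab.metric.HasLeviCivita] {p : slice} {γ : ℝ → slabCut}
    {dom : Set ℝ}
    (h : slab.metric.IsNormalisedNullRayFrom slab.timeOrientation slab.embed slab.normal p γ dom)
    {t : ℝ} (ht : t ∈ dom) : (γ t : E4) 0 = t := by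
  haveI : slabMetric.toPseudoRiemannianMetric.HasLeviCivita := ‹slab.metric.HasLeviCivita›
  have hmax := h.isMaximalGeodesicOn
  have hopen : IsOpen dom := hmax.isOpen
  have hoc : dom.OrdConnected := hmax.2.1
  have hgeo : IsGeodesicOn slabMetric.toPseudoRiemannianMetric.leviCivita γ dom := hmax.isGeodesicOn
  -- the geodesic equations in the chart: position' = velocity, velocity' = 0
  have hD : ∀ t' ∈ dom,
      HasDerivAt (fun s ↦ (γ s : E4)) (velocity 𝓘(ℝ, E4) γ t') t' ∧
        HasDerivAt (fun s ↦ (velocity 𝓘(ℝ, E4) γ s : E4)) 0 t' := by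
    intro t' ht'
    have h2 := OpensChart.hasDerivAt_of_isGeodesicOn (g := slabMetric.toPseudoRiemannianMetric)
      (G := fun _ : E4 ↦ bilin) (fun _ ↦ rfl) (fun _ ↦ differentiableAt_const _) hgeo ht'
    rw [christoffel_slab_eq_zero, neg_zero] at h2
    exact h2
  -- the velocity is constant on the domain
  have hvel : ∀ t' ∈ dom, (velocity 𝓘(ℝ, E4) γ t' : E4) = velocity 𝓘(ℝ, E4) γ 0 := by
    intro t' ht'
    refine hopen.is_const_of_deriv_eq_zero hoc.isPreconnected
      (fun s hs ↦ (hD s hs).2.differentiableAt.differentiableWithinAt)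
      (fun s hs ↦ (hD s hs).2.deriv) ht' h.zero_mem
  -- its time component is `1`
  set v : E4 := velocity 𝓘(ℝ, E4) γ 0 with hv_def
  have hv0 : v 0 = 1 := by
    have hn := h.2.2.2.2.2
    change bilin v (E4.basisVector 0) = -1 at hn
    rw [bilin_symm, bilin_basisVector_zero_left] at hn
    linarith
  -- so `(γ t)⁰ - t` has zero derivative on the domain, hence is constant `= (γ 0)⁰ - 0 = 0`
  have hF : ∀ t' ∈ dom, HasDerivAt (fun s ↦ (γ s : E4) 0 - s) 0 t' := by
    intro t' ht'
    have h1 := ((EuclideanSpace.proj (0 : Fin 4) : E4 →L[ℝ] ℝ).hasFDerivAt.comp_hasDerivAt t'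
      (hD t' ht').1)
    rw [hvel t' ht'] at h1
    have h1' : HasDerivAt (fun s ↦ (γ s : E4) 0) (v 0) t' := by
      simpa [Function.comp_def] using h1
    have h3 := h1'.sub (hasDerivAt_id' t')
    rwa [hv0, sub_self] at h3
  have hconst := hopen.is_const_of_deriv_eq_zero hoc.isPreconnected
    (fun s hs ↦ (hF s hs).differentiableAt.differentiableWithinAt) (fun s hs ↦ (hF s hs).deriv)
    ht h.zero_mem
  have h0 : (γ 0 : E4) 0 = 0 := by
    rw [h.apply_zero]
    change (sliceEmbed p) 0 = 0
    simp [sliceEmbed_apply]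
  rw [h0, sub_zero, sub_eq_zero] at hconst
  exact hconst

/-- **No normalised null ray of the slab from the slice is future complete**: its affine domain lies
in `(-∞, 1)` (the time coordinate `(γ t)⁰ = t` stays `< 1` in the slab). -/
theorem slab_ray_dom_subset_Iio [slab.metric.HasLeviCivita] {p : slice} {γ : ℝ → slabCut}
    {dom : Set ℝ}
    (h : slab.metric.IsNormalisedNullRayFrom slab.timeOrientation slab.embed slab.normal p γ dom) :
    dom ⊆ Iio 1 := fun t ht ↦ by
  have hlt := (slab_apply_zero_mem (γ t)).2
  rwa [slab_ray_time_eq h ht] at hlt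

/-- The affine domain of every normalised null ray of the slab from the slice is bounded above. -/
theorem slab_ray_bddAbove [slab.metric.HasLeviCivita] {p : slice} {γ : ℝ → slabCut}
    {dom : Set ℝ}
    (h : slab.metric.IsNormalisedNullRayFrom slab.timeOrientation slab.embed slab.normal p γ dom) :
    BddAbove dom :=
  ⟨1, fun _ ht ↦ (slab_ray_dom_subset_Iio h ht).le⟩

/-! ### The outer region of hypothesis (ii) is empty; the tameness clause holds -/

/-- **The "outer region" of the slab development is empty**: no point lies in the chronological past
of a future-complete normalised null ray from the data, because there is no such ray. -/
theorem slab_outer_eq_empty [slab.metric.HasLeviCivita] :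
    slab.metric.causalFuture slab.timeOrientation (Set.range slab.embed) ∩
      {q | ∃ (p : slice) (γ : ℝ → slab.carrier) (dom : Set ℝ),
        slab.metric.IsNormalisedNullRayFrom slab.timeOrientation slab.embed slab.normal p γ dom ∧
          ¬ BddAbove dom ∧
            q ∈ slab.metric.chronologicalPast slab.timeOrientation (γ '' (dom ∩ Set.Ici 0))} = ∅ := by
  ext q
  refine ⟨fun hq ↦ ?_, fun hq ↦ hq.elim⟩
  obtain ⟨-, p, γ, dom, hray, hunb, -⟩ := hq
  exact (hunb (slab_ray_bddAbove hray)).elim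

/-- **Hypothesis (ii) (tameness of the outer region) of K2R / Φ holds for the slab development**, in
the exact form of the route decl `PhotonSphereChannels.ChannelsResolveTameDevelopmentsR` instantiated
at `𝒟 := slab`: the outer region is empty (`slab_outer_eq_empty`), so any `r₀ > 0`, `Λ` will do. -/
theorem slab_tame : ∀ [slab.metric.HasLeviCivita],
    let outer : Set slab.carrier :=
      slab.metric.causalFuture slab.timeOrientation (Set.range slab.embed) ∩
        {q | ∃ (p : slice) (γ : ℝ → slab.carrier) (dom : Set ℝ),
          slab.metric.IsNormalisedNullRayFrom slab.timeOrientation slab.embed slab.normal p γ dom ∧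
            ¬ BddAbove dom ∧
              q ∈ slab.metric.chronologicalPast slab.timeOrientation (γ '' (dom ∩ Set.Ici 0))};
    ∃ r₀ : ℝ, 0 < r₀ ∧ ∃ Λ : NNReal, ∀ q ∈ outer,
      let U : TopologicalSpace.Opens E4 := ⟨Metric.ball (0 : E4) r₀, Metric.isOpen_ball⟩;
      ∃ Ψ : U → slab.carrier,
        slab.toSpacetime.IsLateChart (Minkowski.backgroundOn U) Set.univ (-r₀) Ψ ∧
          (∃ x : U, (x : E4) = 0 ∧ Ψ x = q) ∧
            supCkENorm (U : Set E4) 3 (slab.toSpacetime.deviationExtend (Minkowski.backgroundOn U) Ψ) ≤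
              (Λ : ENNReal) ∧
            supCkENorm (U : Set E4) 0 (slab.toSpacetime.deviationExtend (Minkowski.backgroundOn U) Ψ) ≤
              1 / 2 := by
  intro inst outer
  refine ⟨1, one_pos, 0, fun q hq ↦ ?_⟩
  exfalso
  have hq' : q ∈ (∅ : Set slab.carrier) := by rw [← slab_outer_eq_empty]; exact hq
  exact hq'

end Summit.FinalStateConjecture.FinalStateConjecture.Theorems.ChannelsResolveTameDevelopmentsR.Negative

end
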